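import Mathlib
import HarnessLib
import Literature.Probability.Percolation.TwoPointFunction
import Literature.Probability.Percolation.ContinuityCriterion
import Literature.Probability.LatticeModels.CorrelationDecay
import Literature.Barriers.CriticalPhenomena.LaceExpansionXSpaceLemma16

/-!
# `stub_axialMass` of line `registered` (crux `BlockCrossover`, stmt-CriticalPhenomena-11550):
# the axial mass of subcritical bond percolation on `ℤ³` and the sharp bound `τ_p(0, n e₁) ≤ e^{-m n}`

Registered stub of the lead's skeleton `Cruxes/BlockCrossover/Lines/birth.lean` (route
`PercAxialLogConvexity`), proved here DEF-FREE. Write `a(n) := τ_p(0, n e₁) = tau 3 p 0 (Pi.single 0 n)`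
for the axial two-point function of nearest-neighbour bond percolation on `ℤ³`. Claim
(Grimmett 1999, Thm. (6.44): (6.45) and the right half of (6.46), with (6.16)): for `0 < p < p_c(ℤ³)`
there is `m > 0` with `-log a(n)/n → m` (the tree predicate `HasInvCorrLength (tau 3 p 0) m`,
`CorrelationDecay.lean`) and `a(n) ≤ e^{-m n}` for EVERY `n` (constant `1`).

Proof (Fekete):
* `a(m) a(n) ≤ a(m+n)` (`StubAxialMass.tau_axial_supermul`): Harris–FKG for the increasing events
  `{0 ↔ m e₁}`, `{m e₁ ↔ (m+n) e₁}` (`Literature.Barriers.CriticalPhenomena.tau_mul_tau_le_tau`,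
  `τ(x,y) τ(y,z) ≤ τ(x,z)` from `harris_fkg_holds`) and translation invariance `tau_eq_tau_zero_sub`;
* `a(n) > 0` for `p > 0` (`tau_pos`), so `u(n) := -log a(n) ≥ 0` is subadditive and `u(n)/n` is bounded
  below by `0`; Mathlib's `Subadditive.tendsto_lim` / `Subadditive.lim_le_div` give the limit
  `m := lim u(n)/n = inf_{n ≥ 1} u(n)/n`, whence `a(n) ≤ e^{-m n}` for all `n` (`n = 0`: `a(0) = 1`);
* `m > 0` for `p < p_c`: sharpness (`DCT16.perc_sharpness_holds`, Duminil-Copin–Tassion 2016: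
  `P_p(0 ↔ ∂Λ_k) ≤ e^{-c k}`, `c > 0`) and the first-exit bound `a(k+1) ≤ P_p(0 ↔ ∂Λ_k)`
  (`tau_le_real_siteToBoundary`, `(k+1) e₁ ∉ Λ_k`) give `u(k+1)/(k+1) ≥ c k/(k+1) ≥ c/2` for `k ≥ 1`,
  so `m ≥ c/2`.

## References

* G. Grimmett, *Percolation*, 2nd ed., Springer 1999, Thm. (6.44) ((6.45)–(6.46)), (6.16),
  App. II Thm. (II.2) (subadditive limit theorem). [GrimmettPercolation1999]
* H. Duminil-Copin, V. Tassion, CMP 343 (2016), Thm. 1.1(1) (sharpness). [DuminilCopinTassionCMP2016]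
-/

noncomputable section

namespace Summit.CriticalPhenomena.PercolationContinuityZ3.Theorems.BlockCrossover

open MeasureTheory Filter Topology
open Literature.Probability.Percolation Literature.Probability.LatticeModels

namespace StubAxialMass

variable {d : ℕ} [NeZero d]

/-- `(m + n) e₁ - m e₁ = n e₁` on `ℤ^d`. -/
theorem single_natCast_add_sub (m n : ℕ) :
    (Pi.single 0 (((m + n : ℕ) : ℤ)) : Site d) - Pi.single 0 (m : ℤ) = Pi.single 0 (n : ℤ) := by
  rw [sub_eq_iff_eq_add, ← Pi.single_add]
  congr 1
  push_cast
  ring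

/-- **Supermultiplicativity of the axial two-point function** (Grimmett 1999, proof of Thm. (6.44)):
`τ_p(0, m e₁) τ_p(0, n e₁) ≤ τ_p(0, (m+n) e₁)`, from Harris
(`Literature.Barriers.CriticalPhenomena.tau_mul_tau_le_tau` at `0`, `m e₁`, `(m+n) e₁`) and
translation invariance `τ_p(m e₁, (m+n) e₁) = τ_p(0, n e₁)` (`tau_eq_tau_zero_sub`). -/
theorem tau_axial_supermul (p : unitInterval) (m n : ℕ) :
    tau d p 0 (Pi.single 0 (m : ℤ)) * tau d p 0 (Pi.single 0 (n : ℤ)) ≤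
      tau d p 0 (Pi.single 0 ((m + n : ℕ) : ℤ)) := by
  have h := Literature.Barriers.CriticalPhenomena.tau_mul_tau_le_tau p (0 : Site d)
    (Pi.single 0 (m : ℤ)) (Pi.single 0 ((m + n : ℕ) : ℤ))
  rwa [tau_eq_tau_zero_sub p (Pi.single 0 (m : ℤ)), single_natCast_add_sub] at h

/-- `τ_p(0, n e₁) > 0` for `p > 0` (`tau_pos`, `ℤ^d` is connected). -/
theorem tau_axial_pos (p : unitInterval) (hp : 0 < (p : ℝ)) (n : ℕ) :
    0 < tau d p 0 (Pi.single 0 (n : ℤ)) :=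
  tau_pos zdGraph_preconnected_holds p hp _ _

/-- The sequence `u(n) = -log τ_p(0, n e₁)` is subadditive for `p > 0` (logarithm of
`tau_axial_supermul`; Grimmett 1999, proof of Thm. (6.44)). -/
theorem subadditive_neg_log_tau_axial (p : unitInterval) (hp : 0 < (p : ℝ)) :
    Subadditive fun n : ℕ => -Real.log (tau d p 0 (Pi.single 0 (n : ℤ))) := by
  intro m n
  have h := tau_axial_supermul (d := d) p m n
  have hm := tau_axial_pos (d := d) p hp m
  have hn := tau_axial_pos (d := d) p hp n
  have hlog := Real.log_le_log (mul_pos hm hn) h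
  rw [Real.log_mul hm.ne' hn.ne'] at hlog
  dsimp only
  linarith

/-- The terms `-log τ_p(0, n e₁) / n` are nonnegative (`0 ≤ τ ≤ 1`). -/
theorem neg_log_tau_axial_div_nonneg (p : unitInterval) (n : ℕ) :
    0 ≤ -Real.log (tau d p 0 (Pi.single 0 (n : ℤ))) / (n : ℝ) := by
  refine div_nonneg ?_ (Nat.cast_nonneg n)
  rw [neg_nonneg]
  exact Real.log_nonpos (tau_nonneg _ _ _) (tau_le_one _ _ _)

/-- `u(n)/n` is bounded below (by `0`). -/
theorem bddBelow_neg_log_tau_axial_div (p : unitInterval) :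
    BddBelow (Set.range fun n : ℕ => -Real.log (tau d p 0 (Pi.single 0 (n : ℤ))) / (n : ℝ)) :=
  ⟨0, by rintro _ ⟨n, rfl⟩; exact neg_log_tau_axial_div_nonneg p n⟩

/-- **Fekete**: `-log τ_p(0, n e₁) / n → m(p) := lim` of the subadditive sequence (`p > 0`;
Grimmett 1999, Thm. (6.44), (6.45); Mathlib's `Subadditive.tendsto_lim`). -/
theorem tendsto_neg_log_tau_axial_div (p : unitInterval) (hp : 0 < (p : ℝ)) :
    Tendsto (fun n : ℕ => -Real.log (tau d p 0 (Pi.single 0 (n : ℤ))) / (n : ℝ)) atTop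
      (𝓝 (subadditive_neg_log_tau_axial (d := d) p hp).lim) :=
  (subadditive_neg_log_tau_axial p hp).tendsto_lim (bddBelow_neg_log_tau_axial_div p)

/-- **Fekete, `lim = inf`**: `m(p) ≤ -log τ_p(0, n e₁) / n` for every `n ≥ 1` (`p > 0`;
Grimmett 1999, Thm. (6.44), (6.46); Mathlib's `Subadditive.lim_le_div`). -/
theorem lim_le_neg_log_tau_axial_div (p : unitInterval) (hp : 0 < (p : ℝ)) {n : ℕ} (hn : n ≠ 0) :
    (subadditive_neg_log_tau_axial (d := d) p hp).lim ≤
      -Real.log (tau d p 0 (Pi.single 0 (n : ℤ))) / (n : ℝ) :=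
  (subadditive_neg_log_tau_axial p hp).lim_le_div (bddBelow_neg_log_tau_axial_div p) hn

/-- **The sharp a-priori bound** `τ_p(0, n e₁) ≤ e^{-m(p) n}` for every `n` (`p > 0`; Grimmett 1999,
Thm. (6.44), right half of (6.46)). -/
theorem tau_axial_le_exp_neg (p : unitInterval) (hp : 0 < (p : ℝ)) (n : ℕ) :
    tau d p 0 (Pi.single 0 (n : ℤ)) ≤
      Real.exp (-(subadditive_neg_log_tau_axial (d := d) p hp).lim * n) := by
  rcases Nat.eq_zero_or_pos n with rfl | hn
  · simp
  · have hn' : (0 : ℝ) < n := by exact_mod_cast hn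
    have h := lim_le_neg_log_tau_axial_div (d := d) p hp (n := n) (by omega)
    rw [le_div_iff₀ hn'] at h
    rw [← Real.log_le_iff_le_exp (tau_axial_pos p hp n)]
    linarith

/-- `n • e₁ = n e₁`: `(n : ℤ) • Pi.single 0 1 = Pi.single 0 n` on `ℤ^d`. -/
theorem natCast_zsmul_single_one (n : ℕ) :
    ((n : ℤ) • Pi.single (0 : Fin d) (1 : ℤ) : Site d) = Pi.single 0 (n : ℤ) := by
  rw [← Pi.single_smul, smul_eq_mul, mul_one]

/-- The Fekete limit is the tree's axial inverse correlation length: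
`HasInvCorrLength (tau d p 0) m(p)` (`p > 0`; `|τ| = τ`). -/
theorem hasInvCorrLength_tau (p : unitInterval) (hp : 0 < (p : ℝ)) :
    HasInvCorrLength (tau d p 0) (subadditive_neg_log_tau_axial (d := d) p hp).lim := by
  unfold HasInvCorrLength
  refine (tendsto_neg_log_tau_axial_div (d := d) p hp).congr fun n => ?_
  rw [natCast_zsmul_single_one, abs_of_nonneg (tau_nonneg _ _ _)]

/-- `(k+1) e₁ ∉ Λ_k`. -/
theorem single_succ_notMem_box (k : ℕ) :
    (Pi.single 0 (((k + 1 : ℕ) : ℤ)) : Site d) ∉ box d k := by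
  intro h
  have h0 := ((mem_box.1 h) 0).2
  simp at h0

/-- **Positivity of the mass below `p_c`** (Grimmett 1999, (6.16); here from sharpness,
Duminil-Copin–Tassion 2016, Thm. 1.1(1), `DCT16.perc_sharpness_holds`, and the first-exit bound
`tau_le_real_siteToBoundary`): for `0 < p < p_c(ℤ^d)`, `d ≥ 2`, the Fekete limit is `> 0`. -/
theorem lim_pos (hd : 2 ≤ d) (p : unitInterval) (hp : 0 < (p : ℝ))
    (hpc : (p : ℝ) < criticalProb (zdGraph d) 0) :
    0 < (subadditive_neg_log_tau_axial (d := d) p hp).lim := by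
  obtain ⟨c, hc, hdec⟩ := DCT16.perc_sharpness_holds hd p hpc
  have hge : c / 2 ≤ (subadditive_neg_log_tau_axial (d := d) p hp).lim := by
    refine ge_of_tendsto (tendsto_neg_log_tau_axial_div (d := d) p hp) ?_
    filter_upwards [eventually_ge_atTop 2] with n hn
    obtain ⟨k, rfl⟩ : ∃ k, n = k + 1 := ⟨n - 1, by omega⟩
    have hk : (1 : ℝ) ≤ k := by exact_mod_cast (show 1 ≤ k by omega)
    have hk' : (0 : ℝ) < ((k + 1 : ℕ) : ℝ) := by positivity
    have ha := (tau_le_real_siteToBoundary p (single_succ_notMem_box (d := d) k)).trans (hdec k)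
    have hlog := Real.log_le_log (tau_axial_pos (d := d) p hp (k + 1)) ha
    rw [Real.log_exp] at hlog
    have hck : 0 ≤ c * ((k : ℝ) - 1) := mul_nonneg hc.le (sub_nonneg.2 hk)
    have hcast : ((k + 1 : ℕ) : ℝ) = (k : ℝ) + 1 := by push_cast; ring
    rw [le_div_iff₀ hk', hcast]
    nlinarith
  linarith

end StubAxialMass

/-- **`stub_axialMass`** (registered stub 1 of line `registered`, crux `BlockCrossover`): for
`0 < p < p_c(ℤ³)` the axial two-point function `τ_p(0, n e₁) = tau 3 p 0 (Pi.single 0 n)` of bond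
percolation on `ℤ³` has a mass `m > 0` — `-log τ_p(0, n e₁)/n → m`, the tree's
`HasInvCorrLength (tau 3 p 0) m` — and satisfies the SHARP a-priori bound `τ_p(0, n e₁) ≤ e^{-m n}`
for every `n` (Grimmett 1999, Thm. (6.44): (6.45) and right half of (6.46), by Harris–FKG
supermultiplicativity + Fekete; `m > 0` below `p_c` by sharpness, Duminil-Copin–Tassion 2016). -/
theorem stub_axialMass :
    ∀ p : unitInterval, 0 < (p : ℝ) → p < criticalProbI 3 →
      ∃ m : ℝ, 0 < m ∧ HasInvCorrLength (tau 3 p 0) m ∧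
        ∀ n : ℕ, tau 3 p 0 (Pi.single 0 (n : ℤ)) ≤ Real.exp (-m * n) := by
  intro p hp hpc
  have hpc' : (p : ℝ) < criticalProb (zdGraph 3) 0 := by
    rw [← coe_criticalProbI]
    exact Subtype.coe_lt_coe.2 hpc
  exact ⟨_, StubAxialMass.lim_pos (d := 3) (by norm_num) p hp hpc',
    StubAxialMass.hasInvCorrLength_tau p hp, StubAxialMass.tau_axial_le_exp_neg p hp⟩

end Summit.CriticalPhenomena.PercolationContinuityZ3.Theorems.BlockCrossover

end
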